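import Summits.Ventures.Crystal3D.Theorems.StickyWulffConstantGenericWallFloorMixedDozenRules
import HarnessLib

/-!
# The site ledger at a lattice ball: `deg p = #occupied slots + #foreign neighbours`

HONEST FRAMING. Part of the venture `Summits/Ventures/Crystal3D` (cell `crystal3d-full`), helper for the
crux `GenericWallFloor` (stmt-Ventures-19480) of `route-Ventures-StickyWulffConstant`, line `WallLedgerG`,
module M2a of the rigid-bicrystal rung (RIGID-RUNG-ARCH on the item).  Rung credit only.

For a ball `p` of a moved fcc lattice `Λ = A·Λ₀ + t` inside a finite configuration `X`, the neighbours of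
`p` (points of `X` at distance exactly `1`) split into the OWN ones — points of `Λ`, which sit exactly at
the twelve slot positions `p + A w`, `w ∈ fccSlots` — and the FOREIGN ones (not on `Λ`).  Hence
`#N(p) = #{w ∈ fccSlots : p + A w ∈ X} + #{q ∈ N(p) : q ∉ Λ}` (`card_neighbours_eq_occupied_add_foreign`)
and the ledger entry `12 − #N(p) = #(empty slots) − #(foreign neighbours)` (`twelve_sub_degree_eq`), which
is summed over the grain in the two-lattice ledger `2·D(X) = Σ_x (12 − #N(x))`
(`Literature…excessEnergy_coe`, `contactDeficiency_two_grains`).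
-/

noncomputable section

namespace Summit.Ventures.Crystal3D.Theorems

open Summit.Ventures.Crystal3D Finset
open Literature.MathematicalPhysics.StatisticalMechanics (barlowPos fccStacking constHagg)
open scoped InnerProductSpace

/-- Own neighbours sit at slots: if `p, q ∈ A·Λ₀ + t` and `dist p q = 1` then `q = p + A w` for a
(unique) slot `w = A⁻¹(q − p) ∈ fccSlots`. -/
theorem symm_sub_mem_fccSlots (A : EuclideanSpace ℝ (Fin 3) ≃ₗᵢ[ℝ] EuclideanSpace ℝ (Fin 3))
    (t p q : EuclideanSpace ℝ (Fin 3))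
    (hp : p ∈ (fun x => A x + t) '' fccStacking 1 (Real.sqrt (2 / 3)))
    (hq : q ∈ (fun x => A x + t) '' fccStacking 1 (Real.sqrt (2 / 3))) (hpq : dist p q = 1) :
    A.symm (q - p) ∈ fccSlots := by
  obtain ⟨p₀, hp₀, rfl⟩ := hp
  obtain ⟨q₀, hq₀, rfl⟩ := hq
  have hsub : (A q₀ + t) - (A p₀ + t) = A (q₀ - p₀) := by simp [map_sub]
  rw [hsub, LinearIsometryEquiv.symm_apply_apply]
  refine sub_mem_fccSlots_of_dist_eq_one hp₀ hq₀ ?_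
  rw [dist_eq_norm, ← LinearIsometryEquiv.norm_map A, map_sub, ← dist_eq_norm]
  simpa [dist_eq_norm] using hpq

open scoped Classical in
/-- **Neighbour split at a lattice ball.**  For `p ∈ Λ = A·Λ₀ + t` and a finite `X`, the number of points
of `X` at distance `1` from `p` equals the number of OCCUPIED slots `#{w ∈ fccSlots : p + A w ∈ X}` plus the
number of FOREIGN neighbours `#{q ∈ X : dist p q = 1, q ∉ Λ}`. -/
theorem card_neighbours_eq_occupied_add_foreign
    (A : EuclideanSpace ℝ (Fin 3) ≃ₗᵢ[ℝ] EuclideanSpace ℝ (Fin 3)) (t p : EuclideanSpace ℝ (Fin 3))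
    (X : Finset (EuclideanSpace ℝ (Fin 3)))
    (hp : p ∈ (fun x => A x + t) '' fccStacking 1 (Real.sqrt (2 / 3))) :
    (X.filter fun q => dist p q = 1).card =
      (fccSlots.filter fun w => p + A w ∈ X).card +
        (X.filter fun q => dist p q = 1 ∧ q ∉ (fun x => A x + t) '' fccStacking 1 (Real.sqrt (2 / 3))).card := by
  classical
  set Λ : Set (EuclideanSpace ℝ (Fin 3)) := (fun x => A x + t) '' fccStacking 1 (Real.sqrt (2 / 3)) with hΛ
  -- split the neighbours by membership in Λ
  have hsplit := (Finset.card_filter_add_card_filter_not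
    (s := X.filter fun q => dist p q = 1) (fun q => q ∈ Λ)).symm
  rw [Finset.filter_filter, Finset.filter_filter] at hsplit
  rw [hsplit]
  congr 1
  -- the Λ-neighbours are in bijection with the occupied slots via `w ↦ p + A w`
  symm
  refine Finset.card_bij (fun w _ => p + A w) ?_ ?_ ?_
  · intro w hw
    rw [Finset.mem_filter] at hw ⊢
    obtain ⟨hws, hwX⟩ := hw
    refine ⟨hwX, ?_, ?_⟩
    · rw [dist_eq_norm, show p - (p + A w) = -(A w) by abel, norm_neg, LinearIsometryEquiv.norm_map,
        norm_eq_one_of_mem_fccSlots hws]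
    · obtain ⟨p₀, hp₀, hp₀e⟩ := hp
      simp only at hp₀e
      refine ⟨p₀ + w, fcc_add_site_mem hp₀ (mem_fcc_of_mem_fccSlots hws), ?_⟩
      simp only [map_add]
      rw [← hp₀e]; abel
  · intro w₁ hw₁ w₂ hw₂ h
    have : A w₁ = A w₂ := add_left_cancel h
    exact A.injective this
  · intro q hq
    rw [Finset.mem_filter] at hq
    obtain ⟨hqX, hd, hqΛ⟩ := hq
    refine ⟨A.symm (q - p), ?_, ?_⟩
    · rw [Finset.mem_filter]
      refine ⟨symm_sub_mem_fccSlots A t p q hp hqΛ hd, ?_⟩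
      rw [LinearIsometryEquiv.apply_symm_apply, add_sub_cancel]
      exact hqX
    · rw [LinearIsometryEquiv.apply_symm_apply, add_sub_cancel]

open scoped Classical in
/-- **The ledger entry of a lattice ball.**  With `e(p) = #{w ∈ fccSlots : p + A w ∉ X}` (EMPTY slots) and
`c(p) = #{q ∈ X : dist p q = 1, q ∉ Λ}` (FOREIGN neighbours):  `12 − #N(p) = e(p) − c(p)`. -/
theorem twelve_sub_degree_eq
    (A : EuclideanSpace ℝ (Fin 3) ≃ₗᵢ[ℝ] EuclideanSpace ℝ (Fin 3)) (t p : EuclideanSpace ℝ (Fin 3))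
    (X : Finset (EuclideanSpace ℝ (Fin 3)))
    (hp : p ∈ (fun x => A x + t) '' fccStacking 1 (Real.sqrt (2 / 3))) :
    (12 : ℤ) - ((X.filter fun q => dist p q = 1).card : ℤ) =
      ((fccSlots.filter fun w => p + A w ∉ X).card : ℤ) -
        ((X.filter fun q => dist p q = 1 ∧
          q ∉ (fun x => A x + t) '' fccStacking 1 (Real.sqrt (2 / 3))).card : ℤ) := by
  classical
  have h := card_neighbours_eq_occupied_add_foreign A t p X hp
  have h12 : (fccSlots.filter fun w => p + A w ∈ X).card + (fccSlots.filter fun w => p + A w ∉ X).card = 12 := by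
    rw [Finset.card_filter_add_card_filter_not, card_fccSlots]
  omega

/-- **Foreign neighbours force empty slots (the ledger never goes negative through foreign balls alone):**
if `X` is `1`-separated and the lattice ball `p` has at least one foreign neighbour, then `p` has at least
two EMPTY slots (an adjacent pair) — Rule A of the certified computations, in ledger form `e(p) ≥ 2`. -/
theorem two_le_card_empty_slots_of_foreign
    (A : EuclideanSpace ℝ (Fin 3) ≃ₗᵢ[ℝ] EuclideanSpace ℝ (Fin 3)) (t p q : EuclideanSpace ℝ (Fin 3))
    (X : Finset (EuclideanSpace ℝ (Fin 3)))
    (hp : p ∈ (fun x => A x + t) '' fccStacking 1 (Real.sqrt (2 / 3)))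
    (hq : q ∉ (fun x => A x + t) '' fccStacking 1 (Real.sqrt (2 / 3)))
    (hpq : dist p q = 1) (hqX : q ∈ X)
    (hsep : ∀ x ∈ X, ∀ y ∈ X, x ≠ y → 1 ≤ dist x y) :
    2 ≤ (fccSlots.filter fun w => p + A w ∉ X).card := by
  classical
  obtain ⟨w₁, hw₁, w₂, hw₂, hne, -, -, -, he₁, he₂⟩ :=
    exists_two_adjacent_empty_slots_at_site A t p q X hp hq hpq hqX hsep
  have hsub : ({w₁, w₂} : Finset (EuclideanSpace ℝ (Fin 3))) ⊆ fccSlots.filter fun w => p + A w ∉ X := by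
    intro w hw
    rw [Finset.mem_insert, Finset.mem_singleton] at hw
    rw [Finset.mem_filter]
    rcases hw with rfl | rfl
    · exact ⟨hw₁, he₁⟩
    · exact ⟨hw₂, he₂⟩
  calc 2 = ({w₁, w₂} : Finset (EuclideanSpace ℝ (Fin 3))).card := by rw [Finset.card_pair hne]
    _ ≤ _ := Finset.card_le_card hsub

end Summit.Ventures.Crystal3D.Theorems

end
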